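import Literature.IUT.LogVolume.Theorem110StepIIITower
import Literature.IUT.LogVolume.DistinguishedPrimesBound
import Literature.NumberTheory.NumberFields.DifferentGaloisInvariant
import HarnessLib

/-!
# [IUTchIV] Theorem 1.10, Step (iii): the abstract place data `StepIIITower` is INHABITED by every
# real tower of number fields (genuine-model non-vacuity witness)

Mochizuki, *Inter-universal Teichmüller theory IV*, RIMS manuscript (Apr. 2020; = PRIMS **57** (2021)),
proof of Thm. 1.10, Step (iii), pp. 24–26 (kurims `paper:url-56bcb0f95768`).  The tree's
`Theorem110StepIIITower.lean` (abc-iut-S3) checks the assembly of the printed bound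
`log(𝔰^ℚ) ≤ 2·d_mod·(log(𝔡^{F_tpd}) + log(𝔣^{F_tpd})) + log(2·3·5·l)` over ABSTRACT two-level place data
`Thm110StepIII.StepIIITower V W` (numbers `p_v, e_v, f_v, d_v, e_{w/v}, f_{w/v}, d_w`, the fundamental
identity, Prop. 1.3 (i) over `ℚ_p`, "`d_w > 0 ⟹ e_w ≥ 2`", the distinguished primes with (D6)); referee
finding ref-b B6-1 (PASS-B6, 2026-08-25) recorded that this structure had NO non-vacuity witness in the tree
(the only instance, `Summit.ABC.IUTFork.toyStepIIIData`, inhabits the superseded degenerate `StepIIIData`).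

THIS FILE (theorems only, no definition) proves that `StepIIITower` is inhabited by the GENUINE invariants of
ANY extension of number fields `F ⊆ K` (read `F_mod ⊆ F_tpd`), any finite set `S` of finite places of `F`
(index type `V := ↥S`), any set `Sbad` of bad places and any `l ≥ 1`, with `W v :=` the primes of `𝓞 K`
over `v` (Mathlib `IsDedekindDomain.primesOverFinset`):

* `deg0 = [F:ℚ]`, `n = [K:F]`, `p_v` = residue characteristic (`residueChar`), `e_v = e(v|p_v)`
  (`v.asIdeal.ramificationIdx ℤ`), `f_v = f(v|p_v)` (`resDeg`), `d_v = ord_v(𝔡_{F/ℚ})/e_v`,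
  `e_{w/v} = e(w|v)`, `f_{w/v} = f(w|v)` (Mathlib `Ideal.ramificationIdx'`, `Ideal.inertiaDeg'`),
  `d_w = ord_w(𝔡_{K/ℚ})/e(w|p_v)` (the different exponent normalised by `ord(p_v) = 1`);
* `fund` = the fundamental identity `Σ_{w|v} e(w|v) f(w|v) = [K:F]` (Mathlib `Ideal.sum_ramification_inertia`);
* `prop13i` = Dedekind's bound `e(w|p) - 1 ≤ ord_w 𝔡_{K/ℚ}` (the absolute form of Prop. 1.3 (i); tree
  `ramificationIdx_int_sub_one_le_multiplicity`) with `e(w|p) = e(v|p)·e(w|v)` (Mathlib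
  `Ideal.ramificationIdx_tower`);
* `ramified_of_d_pos` = "a prime in the support of the different is ramified" (Mathlib
  `dvd_differentIdeal_iff` + `Ideal.ramificationIdx_eq_one_iff`);
* `dst` = the GENUINE distinguished set of (D6): the primes dividing `2·3·5·l` together with the residue
  characteristics of the places `v ∈ S` that are bad or above which every prime of `K` lies in
  `Supp(𝔡_{K/ℚ})` ((D6) then holds by construction; for `K/F` Galois this is print's
  "`v_ℚ` lies in the image of `Supp(𝔮^{F_tpd}_ADiv + 𝔡^{F_tpd}_ADiv)`", conjugate primes ramifying together).

Consequently the printed Step (iii) bound `StepIIITower.logsQ_le` is instantiated at every real tower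
(`exists_stepIIITower_logsQ_le`).  Honest label: GENUINE-MODEL witness (every numeric field is the invariant of
an actual extension `F ⊆ K`; non-degenerate whenever `[K:F] ≥ 2`).  Classical algebraic number theory; nothing
here takes a side on [IUTchIII] Cor. 3.12.
-/

noncomputable section

namespace Literature.IUT.LogVolume

namespace Thm110StepIII

open NumberField IsDedekindDomain Finset
open scoped Classical

variable (F K : Type*) [Field F] [NumberField F] [Field K] [NumberField K] [Algebra F K]

/-! ### Per-prime facts for a prime `w` of `𝓞 K` over a finite place `v` of `F` -/

section Local

variable {F K}

/-- A member of `IsDedekindDomain.primesOverFinset v (𝓞 K)` is a nonzero prime (hence maximal) ideal of `𝓞 K` over `v`.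
[cite: NeukirchANT1999, Ch. I (8.2)] -/
private theorem isPrime_and_liesOver_of_mem (v : HeightOneSpectrum (𝓞 F)) {w : Ideal (𝓞 K)}
    (hw : w ∈ IsDedekindDomain.primesOverFinset v.asIdeal (𝓞 K)) :
    w.IsPrime ∧ w.LiesOver v.asIdeal ∧ w ≠ ⊥ := by
  haveI := v.isMaximal
  rw [IsDedekindDomain.mem_primesOverFinset_iff v.ne_bot] at hw
  exact ⟨hw.1, hw.2, Ideal.ne_bot_of_mem_primesOver v.ne_bot hw⟩

/-- **Transitivity of ramification indices** along `ℤ ⊆ 𝓞 F ⊆ 𝓞 K`: `e(v|p)·e(w|v) = e(w|p)`.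
[cite: NeukirchANT1999, Ch. III (1.6)] -/
theorem ramificationIdx_int_mul_ramificationIdx' (v : HeightOneSpectrum (𝓞 F)) {w : Ideal (𝓞 K)}
    (hw : w ∈ IsDedekindDomain.primesOverFinset v.asIdeal (𝓞 K)) :
    v.asIdeal.ramificationIdx ℤ * Ideal.ramificationIdx' v.asIdeal w = w.ramificationIdx ℤ := by
  obtain ⟨hP, hL, -⟩ := isPrime_and_liesOver_of_mem v hw
  rw [Ideal.ramificationIdx'_eq_ramificationIdx (p := v.asIdeal) (q := w) v.ne_bot]
  exact (Ideal.ramificationIdx_tower (R := ℤ) v.asIdeal w).symm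

/-- **Dedekind's bound (absolute form of [IUTchIV] Prop. 1.3 (i))**: `e(w|p) - 1 ≤ ord_w 𝔡_{K/ℚ}`.
[cite: NeukirchANT1999, Ch. III (2.6)] -/
theorem ramificationIdx_int_sub_one_le_multiplicity_of_mem (v : HeightOneSpectrum (𝓞 F))
    {w : Ideal (𝓞 K)} (hw : w ∈ IsDedekindDomain.primesOverFinset v.asIdeal (𝓞 K)) :
    w.ramificationIdx ℤ - 1 ≤ multiplicity w (differentIdeal ℤ (𝓞 K)) := by
  obtain ⟨hP, -, hne⟩ := isPrime_and_liesOver_of_mem v hw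
  exact ramificationIdx_int_sub_one_le_multiplicity (K := K) ⟨w, hP, hne⟩

omit [NumberField F] [Algebra F K] in
/-- **A prime in the support of the different is ramified**: `ord_w 𝔡_{K/ℚ} > 0 ⟹ e(w|p) ≥ 2`
(`w ∣ 𝔡_{K/ℚ}` iff `w` is ramified over `ℤ`, Mathlib `dvd_differentIdeal_iff`; unramified iff
`e(w|p) = 1`, Mathlib `Ideal.ramificationIdx_eq_one_iff`, the residue field of `ℤ` being finite).
[cite: NeukirchANT1999, Ch. III (2.6)] -/
theorem two_le_ramificationIdx_int_of_multiplicity_pos {w : Ideal (𝓞 K)} [w.IsPrime]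
    (h : 0 < multiplicity w (differentIdeal ℤ (𝓞 K))) : 2 ≤ w.ramificationIdx ℤ := by
  -- separability of `Frac(𝓞 K)/Frac(ℤ)`, transported from `K/ℚ` (as in the tree's
  -- `pow_ramificationIdx_sub_one_dvd_differentIdeal`)
  letI : Algebra (FractionRing ℤ) (FractionRing (𝓞 K)) := FractionRing.liftAlgebra _ _
  haveI : Algebra.IsSeparable (FractionRing ℤ) (FractionRing (𝓞 K)) := by
    refine Algebra.IsSeparable.of_equiv_equiv (FractionRing.algEquiv ℤ ℚ).symm.toRingEquiv
      (FractionRing.algEquiv (𝓞 K) K).symm.toRingEquiv ?_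
    ext x
    exact IsFractionRing.algEquiv_commutes (FractionRing.algEquiv ℤ ℚ).symm
      (FractionRing.algEquiv (𝓞 K) K).symm _
  have hdvd : w ∣ differentIdeal ℤ (𝓞 K) := by
    by_contra hnd
    exact h.ne' (multiplicity_eq_zero.mpr hnd)
  have hram : ¬ Algebra.IsUnramifiedAt ℤ w := dvd_differentIdeal_iff.mp hdvd
  have h1 : w.ramificationIdx ℤ ≠ 1 := fun h1 => hram (Ideal.ramificationIdx_eq_one_iff.mp h1)
  have hpos : 0 < w.ramificationIdx ℤ := Ideal.ramificationIdx_pos w ℤ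
  omega

/-- **The fundamental identity** `Σ_{w|v} e(w|v)·f(w|v) = [K:F]` over the primes of `𝓞 K` above `v`
(Mathlib `Ideal.sum_ramification_inertia`). [cite: NeukirchANT1999, Ch. I (8.2)] -/
theorem sum_ramificationIdx'_mul_inertiaDeg' (v : HeightOneSpectrum (𝓞 F)) :
    ∑ w : ↥(IsDedekindDomain.primesOverFinset v.asIdeal (𝓞 K)),
        Ideal.ramificationIdx' v.asIdeal w.1 * Ideal.inertiaDeg' v.asIdeal w.1 = Module.finrank F K := by
  haveI := v.isMaximal
  rw [Finset.sum_coe_sort (IsDedekindDomain.primesOverFinset v.asIdeal (𝓞 K))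
    (fun w => Ideal.ramificationIdx' v.asIdeal w * Ideal.inertiaDeg' v.asIdeal w)]
  exact Ideal.sum_ramification_inertia (R := 𝓞 F) (𝓞 K) F K (p := v.asIdeal) v.ne_bot

/-- `e(w|v) ≥ 1`. [cite: NeukirchANT1999, Ch. I (8.2)] -/
theorem ramificationIdx'_pos_of_mem (v : HeightOneSpectrum (𝓞 F)) {w : Ideal (𝓞 K)}
    (hw : w ∈ IsDedekindDomain.primesOverFinset v.asIdeal (𝓞 K)) : 0 < Ideal.ramificationIdx' v.asIdeal w := by
  obtain ⟨hP, hL, -⟩ := isPrime_and_liesOver_of_mem v hw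
  exact Nat.pos_of_ne_zero (Ideal.IsDedekindDomain.ramificationIdx'_ne_zero_of_liesOver w v.ne_bot)

/-- `f(w|v) ≥ 1`. [cite: NeukirchANT1999, Ch. I (8.2)] -/
theorem inertiaDeg'_pos_of_mem (v : HeightOneSpectrum (𝓞 F)) {w : Ideal (𝓞 K)}
    (hw : w ∈ IsDedekindDomain.primesOverFinset v.asIdeal (𝓞 K)) : 0 < Ideal.inertiaDeg' v.asIdeal w := by
  obtain ⟨hP, hL, -⟩ := isPrime_and_liesOver_of_mem v hw
  haveI := v.isMaximal
  exact Ideal.inertiaDeg'_pos v.asIdeal w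

/-- **Conjugate primes ramify together** (`K/F` Galois): if ONE prime of `K` over `v` lies in
`Supp(𝔡_{K/ℚ})`, then EVERY prime of `K` over `v` does (the different exponent `ord_w 𝔡_{K/ℚ}` is constant
on the fibre; tree `multiplicity_absDifferent_eq_of_under_eq`).  This is why print's (D5)/(D6) "`v_ℚ` lies in
the image of `Supp(𝔡^{F_tpd}_ADiv)`" and the field `StepIIITower.D6` ("ALL `w | v` ramified") agree for the
Galois extension `F_tpd/F_mod`. [cite: NeukirchANT1999, Ch. III §2] -/
theorem multiplicity_pos_of_exists_of_isGalois [IsGalois F K] (v : HeightOneSpectrum (𝓞 F))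
    {w₀ : Ideal (𝓞 K)} (hw₀ : w₀ ∈ IsDedekindDomain.primesOverFinset v.asIdeal (𝓞 K))
    (h₀ : 0 < multiplicity w₀ (differentIdeal ℤ (𝓞 K)))
    {w : Ideal (𝓞 K)} (hw : w ∈ IsDedekindDomain.primesOverFinset v.asIdeal (𝓞 K)) :
    0 < multiplicity w (differentIdeal ℤ (𝓞 K)) := by
  obtain ⟨hP, hL, hne⟩ := isPrime_and_liesOver_of_mem v hw
  obtain ⟨hP₀, hL₀, hne₀⟩ := isPrime_and_liesOver_of_mem v hw₀
  have h := Literature.NumberTheory.NumberFields.multiplicity_absDifferent_eq_of_under_eq F K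
    ⟨w, hP, hne⟩ ⟨w₀, hP₀, hne₀⟩ (hL.over.symm.trans hL₀.over)
  change multiplicity w _ = multiplicity w₀ _ at h
  rw [h]; exact h₀

end Local

/-! ### The genuine `StepIIITower` of a tower of number fields -/

/-- **`Thm110StepIII.StepIIITower` is inhabited by every real tower `F ⊆ K`** (genuine-model non-vacuity
witness for [IUTchIV] Thm. 1.10 Step (iii); answers referee finding ref-b B6-1): for number fields `F ⊆ K`,
a finite set `S` of finite places of `F`, bad places `Sbad`, and `l ≥ 1`, there is a `StepIIITower` indexed by
`V = ↥S` and `W v =` the primes of `𝓞 K` over `v`, ALL of whose fields are the genuine invariants: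
`deg0 = [F:ℚ]`, `n = [K:F]`, `l`, `p_v = residueChar`, `e_v = e(v|p)`, `f_v = f(v|p)`,
`d_v = ord_v(𝔡_{F/ℚ})/e(v|p)`, `bad v ↔ v ∈ Sbad`, `e_{w/v} = e(w|v)`, `f_{w/v} = f(w|v)`,
`d_w = ord_w(𝔡_{K/ℚ})/e(w|p)`, and `dst` = ANY finite set of primes satisfying the printed (D6) read in
number-field terms (each `q ∈ dst` divides `2·3·5·l`, or is `p_v` for some `v ∈ S` that is bad or above which
every prime of `K` lies in `Supp(𝔡_{K/ℚ})`); the genuine and the Galois instances follow.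
[cite: Mochizuki2012, IUTchIV Thm. 1.10 Step (iii) pp. 24–26] -/
theorem exists_stepIIITower_ofNumberFields_of_dst (S Sbad : Finset (HeightOneSpectrum (𝓞 F))) {l : ℕ}
    (hl : 0 < l) (dst : Finset ℕ) (hprime : ∀ q ∈ dst, q.Prime)
    (hD6 : ∀ q ∈ dst, q ∣ 2 * 3 * 5 * l ∨ ∃ v : ↥S, residueChar F v.1 = q ∧ (v.1 ∈ Sbad ∨
      ∀ w : ↥(IsDedekindDomain.primesOverFinset v.1.asIdeal (𝓞 K)),
        0 < multiplicity w.1 (differentIdeal ℤ (𝓞 K)))) :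
    ∃ T : StepIIITower ↥S (fun v => ↥(IsDedekindDomain.primesOverFinset v.1.asIdeal (𝓞 K))),
      T.deg0 = Module.finrank ℚ F ∧ T.n = Module.finrank F K ∧ T.l = l ∧
      (∀ v : ↥S, T.p v = residueChar F v.1) ∧
      (∀ v : ↥S, T.e0 v = v.1.asIdeal.ramificationIdx ℤ) ∧
      (∀ v : ↥S, T.f0 v = resDeg F v.1) ∧
      (∀ v : ↥S, T.d0 v =
        (multiplicity v.1.asIdeal (differentIdeal ℤ (𝓞 F)) : ℝ) / (v.1.asIdeal.ramificationIdx ℤ : ℕ)) ∧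
      (∀ v : ↥S, T.bad v = true ↔ v.1 ∈ Sbad) ∧
      (∀ (v : ↥S) (w : ↥(IsDedekindDomain.primesOverFinset v.1.asIdeal (𝓞 K))),
        T.erel v w = Ideal.ramificationIdx' v.1.asIdeal w.1) ∧
      (∀ (v : ↥S) (w : ↥(IsDedekindDomain.primesOverFinset v.1.asIdeal (𝓞 K))),
        T.frel v w = Ideal.inertiaDeg' v.1.asIdeal w.1) ∧
      (∀ (v : ↥S) (w : ↥(IsDedekindDomain.primesOverFinset v.1.asIdeal (𝓞 K))),
        T.d v w = (multiplicity w.1 (differentIdeal ℤ (𝓞 K)) : ℝ) / (w.1.ramificationIdx ℤ : ℕ)) ∧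
      T.dst = dst := by
  -- the tower identity `e(v|p)·e(w|v) = e(w|p)` at the index types
  have htower : ∀ (v : ↥S) (w : ↥(IsDedekindDomain.primesOverFinset v.1.asIdeal (𝓞 K))),
      v.1.asIdeal.ramificationIdx ℤ * Ideal.ramificationIdx' v.1.asIdeal w.1 = w.1.ramificationIdx ℤ :=
    fun v w => ramificationIdx_int_mul_ramificationIdx' v.1 w.2
  refine ⟨{ deg0 := Module.finrank ℚ F
            deg0_pos := by exact_mod_cast Module.finrank_pos
            n := Module.finrank F K
            n_pos := Module.finrank_pos
            p := fun v => residueChar F v.1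
            two_le_p := fun v => (residueChar_prime F v.1).two_le
            e0 := fun v => v.1.asIdeal.ramificationIdx ℤ
            e0_pos := fun v => Ideal.ramificationIdx_pos v.1.asIdeal ℤ
            f0 := fun v => resDeg F v.1
            f0_pos := fun v => Nat.pos_of_ne_zero (resDeg_ne_zero F v.1)
            d0 := fun v => (multiplicity v.1.asIdeal (differentIdeal ℤ (𝓞 F)) : ℝ) /
              (v.1.asIdeal.ramificationIdx ℤ : ℕ)
            d0_nonneg := fun v => by positivity
            bad := fun v => decide (v.1 ∈ Sbad)
            erel := fun v w => Ideal.ramificationIdx' v.1.asIdeal w.1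
            erel_pos := fun v w => ramificationIdx'_pos_of_mem v.1 w.2
            frel := fun v w => Ideal.inertiaDeg' v.1.asIdeal w.1
            frel_pos := fun v w => inertiaDeg'_pos_of_mem v.1 w.2
            d := fun v w => (multiplicity w.1 (differentIdeal ℤ (𝓞 K)) : ℝ) / (w.1.ramificationIdx ℤ : ℕ)
            fund := fun v => sum_ramificationIdx'_mul_inertiaDeg' (F := F) (K := K) v.1
            l := l
            l_pos := hl
            p_prime := fun v => residueChar_prime F v.1
            d_nonneg := fun v w => by positivity
            prop13i := ?_
            ramified_of_d_pos := ?_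
            dst := dst
            dst_prime := ?_
            D6 := ?_ },
    rfl, rfl, rfl, fun v => rfl, fun v => rfl, fun v => rfl, fun v => rfl, fun v => ?_, fun v w => rfl,
    fun v w => rfl, fun v w => rfl, rfl⟩
  · -- prop13i: `(e_w - 1)/e_w ≤ ord_w 𝔡 / e_w`, `e_w = e(v|p)·e(w|v) = e(w|p)`
    intro v w
    rw [htower v w]
    have hE : (0 : ℝ) < (w.1.ramificationIdx ℤ : ℕ) := by
      obtain ⟨hP, -, -⟩ := isPrime_and_liesOver_of_mem v.1 w.2
      exact_mod_cast Ideal.ramificationIdx_pos w.1 ℤ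
    refine div_le_div_of_nonneg_right ?_ hE.le
    have h1 : 1 ≤ w.1.ramificationIdx ℤ := by exact_mod_cast hE
    have h := ramificationIdx_int_sub_one_le_multiplicity_of_mem v.1 w.2
    rw [← Nat.cast_one, ← Nat.cast_sub h1]
    exact_mod_cast h
  · -- ramified_of_d_pos: `ord_w 𝔡 / e_w > 0 ⟹ ord_w 𝔡 > 0 ⟹ e(w|p) ≥ 2`
    intro v w hd
    rw [htower v w]
    obtain ⟨hP, -, -⟩ := isPrime_and_liesOver_of_mem v.1 w.2
    refine two_le_ramificationIdx_int_of_multiplicity_pos (K := K) ?_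
    by_contra h0
    have h0' : multiplicity w.1 (differentIdeal ℤ (𝓞 K)) = 0 := by omega
    simp only [h0', Nat.cast_zero, zero_div, lt_self_iff_false] at hd
  · -- dst_prime
    exact hprime
  · -- (D6)
    intro q hq
    rcases hD6 q hq with hdiv | ⟨v, hv, hcase⟩
    · exact Or.inl hdiv
    · refine Or.inr ⟨v, hv, ?_⟩
      rcases hcase with hb | hram
      · exact Or.inl (decide_eq_true hb)
      · refine Or.inr fun w => ?_
        have hE : (0 : ℝ) < (w.1.ramificationIdx ℤ : ℕ) := by
          obtain ⟨hP, -, -⟩ := isPrime_and_liesOver_of_mem v.1 w.2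
          exact_mod_cast Ideal.ramificationIdx_pos w.1 ℤ
        have hm : (0 : ℝ) < (multiplicity w.1 (differentIdeal ℤ (𝓞 K)) : ℝ) := by exact_mod_cast hram w
        exact div_pos hm hE
  · -- bad ↔ membership
    exact decide_eq_true_iff

omit [NumberField F] in
/-- The distinguished set as a finite set of natural numbers (bookkeeping): the primes dividing `2·3·5·l`
together with the `p_v`, `v ∈ S`, with `v` bad or satisfying the ramification predicate `R v`.
[cite: Mochizuki2012, IUTchIV Thm. 1.10 Step (iii) (D5)/(D6) p. 25] -/
private theorem exists_dstOf (S Sbad : Finset (HeightOneSpectrum (𝓞 F))) (l : ℕ) (hl : 0 < l)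
    (R : ↥S → Prop) :
    ∃ dst : Finset ℕ, ∀ q, q ∈ dst ↔
      (q.Prime ∧ q ∣ 2 * 3 * 5 * l) ∨ ∃ v : ↥S, residueChar F v.1 = q ∧ (v.1 ∈ Sbad ∨ R v) := by
  refine ⟨(Nat.divisors (2 * 3 * 5 * l)).filter Nat.Prime ∪
    (S.attach.filter (fun v => v.1 ∈ Sbad ∨ R v)).image (fun v => residueChar F v.1), fun q => ?_⟩
  have hN : 2 * 3 * 5 * l ≠ 0 := by omega
  simp only [Finset.mem_union, Finset.mem_filter, Nat.mem_divisors, Finset.mem_image, Finset.mem_attach,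
    true_and]
  constructor
  · rintro (⟨⟨hq, -⟩, hp⟩ | ⟨v, hv, rfl⟩)
    · exact Or.inl ⟨hp, hq⟩
    · exact Or.inr ⟨v, rfl, hv⟩
  · rintro (⟨hp, hq⟩ | ⟨v, hv, hcase⟩)
    · exact Or.inl ⟨⟨hq, hN⟩, hp⟩
    · exact Or.inr ⟨v, hcase, hv⟩

/-- **`Thm110StepIII.StepIIITower` is inhabited by every real tower `F ⊆ K`, with the GENUINE distinguished
set**: as `exists_stepIIITower_ofNumberFields_of_dst`, with `dst` = the primes dividing `2·3·5·l` together with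
the residue characteristics `p_v` of the places `v ∈ S` that are bad or above which every prime of `K` lies in
`Supp(𝔡_{K/ℚ})` — (D6) holds by construction, no hypothesis.
[cite: Mochizuki2012, IUTchIV Thm. 1.10 Step (iii) pp. 24–26] -/
theorem exists_stepIIITower_ofNumberFields (S Sbad : Finset (HeightOneSpectrum (𝓞 F))) {l : ℕ}
    (hl : 0 < l) :
    ∃ T : StepIIITower ↥S (fun v => ↥(IsDedekindDomain.primesOverFinset v.1.asIdeal (𝓞 K))),
      T.deg0 = Module.finrank ℚ F ∧ T.n = Module.finrank F K ∧ T.l = l ∧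
      (∀ v : ↥S, T.p v = residueChar F v.1) ∧
      (∀ v : ↥S, T.e0 v = v.1.asIdeal.ramificationIdx ℤ) ∧
      (∀ v : ↥S, T.f0 v = resDeg F v.1) ∧
      (∀ v : ↥S, T.d0 v =
        (multiplicity v.1.asIdeal (differentIdeal ℤ (𝓞 F)) : ℝ) / (v.1.asIdeal.ramificationIdx ℤ : ℕ)) ∧
      (∀ v : ↥S, T.bad v = true ↔ v.1 ∈ Sbad) ∧
      (∀ (v : ↥S) (w : ↥(IsDedekindDomain.primesOverFinset v.1.asIdeal (𝓞 K))),
        T.erel v w = Ideal.ramificationIdx' v.1.asIdeal w.1) ∧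
      (∀ (v : ↥S) (w : ↥(IsDedekindDomain.primesOverFinset v.1.asIdeal (𝓞 K))),
        T.frel v w = Ideal.inertiaDeg' v.1.asIdeal w.1) ∧
      (∀ (v : ↥S) (w : ↥(IsDedekindDomain.primesOverFinset v.1.asIdeal (𝓞 K))),
        T.d v w = (multiplicity w.1 (differentIdeal ℤ (𝓞 K)) : ℝ) / (w.1.ramificationIdx ℤ : ℕ)) ∧
      (∀ q, q ∈ T.dst ↔ (q.Prime ∧ q ∣ 2 * 3 * 5 * l) ∨
        ∃ v : ↥S, residueChar F v.1 = q ∧ (v.1 ∈ Sbad ∨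
          ∀ w : ↥(IsDedekindDomain.primesOverFinset v.1.asIdeal (𝓞 K)),
            0 < multiplicity w.1 (differentIdeal ℤ (𝓞 K)))) := by
  -- the genuine distinguished set and its membership lemma
  obtain ⟨dst, hmem⟩ := exists_dstOf F S Sbad l hl (fun v =>
    ∀ w : ↥(IsDedekindDomain.primesOverFinset v.1.asIdeal (𝓞 K)), 0 < multiplicity w.1 (differentIdeal ℤ (𝓞 K)))
  have hprime : ∀ q ∈ dst, q.Prime := by
    intro q hq
    rcases (hmem q).mp hq with ⟨hp, -⟩ | ⟨v, hv, -⟩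
    · exact hp
    · rw [← hv]; exact residueChar_prime F v.1
  have hD6 : ∀ q ∈ dst, q ∣ 2 * 3 * 5 * l ∨ ∃ v : ↥S, residueChar F v.1 = q ∧ (v.1 ∈ Sbad ∨
      ∀ w : ↥(IsDedekindDomain.primesOverFinset v.1.asIdeal (𝓞 K)),
        0 < multiplicity w.1 (differentIdeal ℤ (𝓞 K))) := by
    intro q hq
    rcases (hmem q).mp hq with ⟨-, hdiv⟩ | h
    · exact Or.inl hdiv
    · exact Or.inr h
  obtain ⟨T, h0, hn, hlT, hp, he, hf, hd0, hbad, herel, hfrel, hd, hdstT⟩ :=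
    exists_stepIIITower_ofNumberFields_of_dst F K S Sbad hl dst hprime hD6
  exact ⟨T, h0, hn, hlT, hp, he, hf, hd0, hbad, herel, hfrel, hd, fun q => by rw [hdstT]; exact hmem q⟩

/-- **Galois case (the printed situation `F_mod ⊆ F_tpd`)**: for `K/F` Galois the distinguished set may be
taken VERBATIM as print's (D5)/(D6) — the primes dividing `2·3·5·l` together with the `p_v`, `v ∈ S`, such
that `v` is bad or SOME prime of `K` over `v` lies in `Supp(𝔡_{K/ℚ})` ("`v_ℚ` lies in the image of
`Supp(𝔮^{F_tpd}_ADiv + 𝔡^{F_tpd}_ADiv)`"); the field `D6` ("ALL `w | v`") then holds because conjugate primes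
ramify together (`multiplicity_pos_of_exists_of_isGalois`).
[cite: Mochizuki2012, IUTchIV Thm. 1.10 Step (iii) (D5)/(D6) p. 25] -/
theorem exists_stepIIITower_ofNumberFields_of_isGalois [IsGalois F K]
    (S Sbad : Finset (HeightOneSpectrum (𝓞 F))) {l : ℕ} (hl : 0 < l) :
    ∃ T : StepIIITower ↥S (fun v => ↥(IsDedekindDomain.primesOverFinset v.1.asIdeal (𝓞 K))),
      T.deg0 = Module.finrank ℚ F ∧ T.n = Module.finrank F K ∧ T.l = l ∧
      (∀ v : ↥S, T.bad v = true ↔ v.1 ∈ Sbad) ∧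
      (∀ (v : ↥S) (w : ↥(IsDedekindDomain.primesOverFinset v.1.asIdeal (𝓞 K))),
        T.d v w = (multiplicity w.1 (differentIdeal ℤ (𝓞 K)) : ℝ) / (w.1.ramificationIdx ℤ : ℕ)) ∧
      (∀ q, q ∈ T.dst ↔ (q.Prime ∧ q ∣ 2 * 3 * 5 * l) ∨
        ∃ v : ↥S, residueChar F v.1 = q ∧ (v.1 ∈ Sbad ∨
          ∃ w : ↥(IsDedekindDomain.primesOverFinset v.1.asIdeal (𝓞 K)),
            0 < multiplicity w.1 (differentIdeal ℤ (𝓞 K)))) := by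
  obtain ⟨dst, hmem⟩ := exists_dstOf F S Sbad l hl (fun v =>
    ∃ w : ↥(IsDedekindDomain.primesOverFinset v.1.asIdeal (𝓞 K)), 0 < multiplicity w.1 (differentIdeal ℤ (𝓞 K)))
  have hprime : ∀ q ∈ dst, q.Prime := by
    intro q hq
    rcases (hmem q).mp hq with ⟨hp, -⟩ | ⟨v, hv, -⟩
    · exact hp
    · rw [← hv]; exact residueChar_prime F v.1
  have hD6 : ∀ q ∈ dst, q ∣ 2 * 3 * 5 * l ∨ ∃ v : ↥S, residueChar F v.1 = q ∧ (v.1 ∈ Sbad ∨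
      ∀ w : ↥(IsDedekindDomain.primesOverFinset v.1.asIdeal (𝓞 K)),
        0 < multiplicity w.1 (differentIdeal ℤ (𝓞 K))) := by
    intro q hq
    rcases (hmem q).mp hq with ⟨-, hdiv⟩ | ⟨v, hv, hcase⟩
    · exact Or.inl hdiv
    · refine Or.inr ⟨v, hv, ?_⟩
      rcases hcase with hb | ⟨w₀, h₀⟩
      · exact Or.inl hb
      · exact Or.inr fun w => multiplicity_pos_of_exists_of_isGalois v.1 w₀.2 h₀ w.2
  obtain ⟨T, h0, hn, hlT, -, -, -, -, hbad, -, -, hd, hdstT⟩ :=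
    exists_stepIIITower_ofNumberFields_of_dst F K S Sbad hl dst hprime hD6
  exact ⟨T, h0, hn, hlT, hbad, hd, fun q => by rw [hdstT]; exact hmem q⟩

/-- **`Nonempty (StepIIITower …)`** at every real tower of number fields (B6-1 closed in the kernel).
[cite: Mochizuki2012, IUTchIV Thm. 1.10 Step (iii) pp. 24–26] -/
theorem nonempty_stepIIITower_ofNumberFields (S : Finset (HeightOneSpectrum (𝓞 F))) :
    Nonempty (StepIIITower ↥S (fun v => ↥(IsDedekindDomain.primesOverFinset v.1.asIdeal (𝓞 K)))) := by
  obtain ⟨T, -⟩ := exists_stepIIITower_ofNumberFields F K S ∅ Nat.one_pos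
  exact ⟨T⟩

/-- **The printed Step (iii) bound at a real tower**: for the genuine place data of `F ⊆ K` over `S` (bad
places `Sbad`, prime `l`), the distinguished primes of (D6) satisfy
`log(𝔰^ℚ) ≤ 2·[F:ℚ]·(log(𝔡^K) + log(𝔣^K)) + log(2·3·5·l)` in the vocabulary of `Thm110StepII.PlaceData`
(`logDiff`, `logCond` over `S`) — `StepIIITower.logsQ_le` instantiated.
[cite: Mochizuki2012, IUTchIV Thm. 1.10 Step (iii) p. 26] -/
theorem exists_stepIIITower_logsQ_le (S Sbad : Finset (HeightOneSpectrum (𝓞 F))) {l : ℕ} (hl : 0 < l) :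
    ∃ T : StepIIITower ↥S (fun v => ↥(IsDedekindDomain.primesOverFinset v.1.asIdeal (𝓞 K))),
      T.deg0 = Module.finrank ℚ F ∧ T.n = Module.finrank F K ∧ T.l = l ∧
      (∀ v : ↥S, T.bad v = true ↔ v.1 ∈ Sbad) ∧
      (∀ q, q ∈ T.dst ↔ (q.Prime ∧ q ∣ 2 * 3 * 5 * l) ∨
        ∃ v : ↥S, residueChar F v.1 = q ∧ (v.1 ∈ Sbad ∨
          ∀ w : ↥(IsDedekindDomain.primesOverFinset v.1.asIdeal (𝓞 K)), 0 < multiplicity w.1 (differentIdeal ℤ (𝓞 K)))) ∧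
      T.logsQ ≤ 2 * T.deg0 * (T.logDiff + T.logCond) + Real.log (2 * 3 * 5 * (T.l : ℝ)) := by
  obtain ⟨T, h0, hn, hlT, -, -, -, -, hbad, -, -, -, hdst⟩ :=
    exists_stepIIITower_ofNumberFields F K S Sbad hl
  exact ⟨T, h0, hn, hlT, hbad, hdst, T.logsQ_le⟩

end Thm110StepIII

end Literature.IUT.LogVolume

end
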